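import Summits.Ventures.PercRepro.Night2TwoOneFreeCell
import Summits.Ventures.PercRepro.Night2ThreeTwoNineTen

/-!
# PercRepro — **THE `(7, 5)` SHADOW ROW MODULO THE RESIDUES `(2, 0)`, `(2, 1)`: EVERY `(2, 1)` CELL WITH AT LEAST
TWO FAT CLOSURES IS CLOSED** (night-2, gen 28)

`localShadowHall_two_one_five_fatClosures_free` settles every `(2, 1)` cell with at least two fat closures, at every
`|V|`.  The `(2, 1)` residue shrinks to a single clause: «a thin member missing `3 … 6` points AND at most one fat
closure» — **`shadowHall_seven_five_of_residuesZ5`**, the row of record.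
-/

namespace PercRepro.Shadow

open Finset PerFlat ThmH

section SevenFiveZ5

variable {α' : Type} [DecidableEq α']

open scoped Classical in
/-- **THE `(7, 5)` SHADOW ROW FOR EVERY FINITE MATROID MODULO THE RESIDUES `(2, 0)`, `(2, 1)`, THE LATTER WITH AT
MOST ONE FAT CLOSURE**: the `(2, 1)` clause now reads «a thin member missing `3 … 6` points and at most one fat
closure». -/
theorem shadowHall_seven_five_of_residuesZ5
    (h20 : ∀ (N : Matroid α') [N.Finite] (G : Finset α'), CellHyp N G →
      (gr N \ G).card = 2 → kColoops N G = 0 → FatMember N G 6 3 →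
      (FatBasis N G 6 2 ∨ FatMember N G 6 2) →
      (2 ≤ (fatClosures N 5 G 2).card ∨
        ∃ B ∈ thinMembers N 5 G, 2 < (G \ clF N B).card ∧ (G \ clF N B).card < 5) →
      LocalShadowHall N 5 G)
    (h21 : ∀ (N : Matroid α') [N.Finite] (G : Finset α'), CellHyp N G →
      (gr N \ G).card = 2 → kColoops N G = 1 → FatMember N G 5 4 →
      (FatBasis N G 5 3 ∨ FatMember N G 5 3) →
      ((∃ B ∈ thinMembers N 5 G, 2 < (G \ clF N B).card ∧ (G \ clF N B).card < 7) ∧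
          (fatClosures N 5 G 2).card ≤ 1) →
      LocalShadowHall N 5 G)
    (M : Matroid α') [M.Finite] : ShadowHall M 7 5 (phiK 7 5) := by
  apply shadowHall_seven_five_of_residuesZ'' h20
  intro N _ G hcell hd hk hfm hfb hH
  by_cases h2 : 2 ≤ (fatClosures N 5 G 2).card
  · exact localShadowHall_two_one_five_fatClosures_free hcell.2.2.2 hd hk hcell.1 hcell.2.1 h2
  · rcases hH with hfat2 | hmid
    · exact absurd hfat2 h2
    · exact h21 N G hcell hd hk hfm hfb ⟨hmid, by omega⟩

end SevenFiveZ5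

end PercRepro.Shadow
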